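import Summits.BirchSwinnertonDyer.BirchSwinnertonDyer.Theorems.ResidualThetaTransportAtTwoResidualSignedLambdaLowerCMAtTwoFourTermOneSided
import HarnessLib

/-!
# Stub-ideation k4·g23 (`stub_cmLambdaLower`, crux `ResidualThetaCountLowerPureAtTwo`, route RTT) — kernel packet
# «the correction factor is a Λ-element, not a constant»: what `D := 1` in child B⁻ (S132 α) silently assumes about child A

Pure algebra over `Λ = A⟦X⟧` (`A` a complete DVR, `F = Frac A`) on Kato's pinned `𝐇¹_Γ` (`I : IwasawaH1DataCoeff`), λ-currency
`dim_F (F ⊗_A ·)` — the currency of `Theorems.CharIdealLambda` (`…FourTermOneSided` §4 (δ), imported; `…ZetaQuotientComposite`, the landed port of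
k2-g16 / k1-g24, is cited by name but not imported: the farm snapshot does not yet serve that module). No `instance`, no `notation`, no `sorry`, no attribute removal. Nothing about any curve or form is
asserted; BSD is NOT proved by any of this; 22608 / 24105 / 26074 stay OPEN / HOLD.

* §1 `BminusD` — the `D`-decorated package-free child B (S3″'s own `(ii)`-pair with its slack `+ λ(Λ/(D))`), and
  `bminusD_one_iff` — at `D := 1` it is literally S132 α's B⁻ (`λ(Λ/(1)) = 0`, `finrank_baseChange_quotient_span_one`).
* §2 `finrank_baseChange_quotient_span_C` — an `𝒪`-CONSTANT decoration is λ-invisible (`λ(Λ/(C c)) = 0`, `c ≠ 0`): the exact scope of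
  «constants wash out».
* §3 `bminus_smul_iff` — THE CERTIFICATE: for a decorated class `z = D • z₀` (`z₀` torsion-free, `𝐇¹/Λz₀` torsion) the UNdecorated B⁻
  `λ(𝐇¹/Λ(D•z₀)) ≤ λ(X₀)` is EQUIVALENT to `λ(𝐇¹/Λz₀) + λ(Λ/(D)) ≤ λ(X₀)` — stronger than the print∘port clause for `z₀` by exactly
  `λ(Λ/(D))` (landed `finrank_baseChange_quotient_span_smul_eq_add`); `bminusD_smul_of_bminus` — the consistent booking
  (B⁻ for `z₀` ⇒ `BminusD` for `(D • z₀, D)`, = landed `ii_clauses_of_composite`).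
* §4 `one_le_finrank_baseChange_quotient_of_X_dvd` — a decoration vanishing at the trivial character (`X ∣ D`) costs `≥ 1`.
-/

set_option autoImplicit false
set_option linter.dupNamespace false

noncomputable section

open scoped TensorProduct Classical

namespace Summit.BirchSwinnertonDyer.BirchSwinnertonDyer.Cruxes.ResidualThetaCountLowerPureAtTwo.SideaK4G23

open Literature.NumberTheory.EllipticCurves Literature.NumberTheory.EllipticCurves.Kato2004
open Literature.NumberTheory.GaloisRepresentations
open Summit.BirchSwinnertonDyer.BirchSwinnertonDyer.Theorems
open Summit.BirchSwinnertonDyer.BirchSwinnertonDyer.Theorems.CharIdealLambda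

/-! ## §2 (stated first, no Kato binders) Constant decorations are λ-invisible; the unit decoration -/

section Constants

variable {A : Type} [CommRing A] (F : Type) [Field F] [Algebra A F] [IsFractionRing A F]

/-- `λ(Λ/(C c)) = 0` for a nonzero CONSTANT `c ∈ A`: `Λ/(C c)` is killed by `c`, which is a unit in `F`, so `F ⊗_A Λ/(C c) = 0`.
This is the precise scope of «constants wash out» (S132 α / `ZetaQuotientComposite` §2). [cite: Washington1997, §13.2] -/
theorem finrank_baseChange_quotient_span_C (c : A) (hc : c ≠ 0) :
    Module.finrank F (F ⊗[A] (PowerSeries A ⧸ Ideal.span {(PowerSeries.C c : PowerSeries A)})) = 0 := by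
  set J : Ideal (PowerSeries A) := Ideal.span {(PowerSeries.C c : PowerSeries A)} with hJ
  have hkill : ∀ n : PowerSeries A ⧸ J, c • n = 0 := fun n => by
    obtain ⟨g, rfl⟩ := Ideal.Quotient.mk_surjective n
    have hcg : c • g = PowerSeries.C c * g := by
      ext k
      simp
    rw [← Ideal.Quotient.mk_eq_mk, ← Submodule.Quotient.mk_smul, Ideal.Quotient.mk_eq_mk, hcg,
      Ideal.Quotient.eq_zero_iff_mem, hJ]
    exact Ideal.mul_mem_right _ _ (Ideal.mem_span_singleton_self _)
  have hu : algebraMap A F c ≠ 0 := fun h => hc (IsFractionRing.injective A F (by rw [h, map_zero]))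
  have hzero : ∀ x : F ⊗[A] (PowerSeries A ⧸ J), x = 0 := fun x =>
    x.induction_on rfl
      (fun y n => by
        calc y ⊗ₜ[A] n = (c • (y * (algebraMap A F c)⁻¹)) ⊗ₜ[A] n := by
              rw [Algebra.smul_def, mul_comm, inv_mul_cancel_right₀ hu]
          _ = (y * (algebraMap A F c)⁻¹) ⊗ₜ[A] (c • n) := TensorProduct.smul_tmul _ _ _
          _ = 0 := by rw [hkill, TensorProduct.tmul_zero])
      (fun a b ha hb => by rw [ha, hb, add_zero])
  haveI : Subsingleton (F ⊗[A] (PowerSeries A ⧸ J)) := ⟨fun a b => by rw [hzero a, hzero b]⟩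
  exact Module.finrank_zero_of_subsingleton

omit [IsFractionRing A F] in
/-- `λ(Λ/(1)) = 0` (the unit decoration): `Λ/(1) = 0`. [folklore] -/
theorem finrank_baseChange_quotient_span_one :
    Module.finrank F (F ⊗[A] (PowerSeries A ⧸ Ideal.span {(1 : PowerSeries A)})) = 0 := by
  haveI : Subsingleton (PowerSeries A ⧸ Ideal.span {(1 : PowerSeries A)}) :=
    Ideal.Quotient.subsingleton_iff.mpr (Ideal.span_singleton_one)
  have hzero : ∀ x : F ⊗[A] (PowerSeries A ⧸ Ideal.span {(1 : PowerSeries A)}), x = 0 := fun x =>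
    x.induction_on rfl (fun y n => by rw [Subsingleton.elim n 0, TensorProduct.tmul_zero])
      (fun a b ha hb => by rw [ha, hb, add_zero])
  haveI : Subsingleton (F ⊗[A] (PowerSeries A ⧸ Ideal.span {(1 : PowerSeries A)})) :=
    ⟨fun a b => by rw [hzero a, hzero b]⟩
  exact Module.finrank_zero_of_subsingleton

end Constants

/-! ## §4 A decoration vanishing at the trivial character costs at least one -/

section TrivialZero

variable {A : Type} [CommRing A] (F : Type) [Field F] [Algebra A F]

/-- The constant-term functional descends to `Λ/(D)` when `X ∣ D` (`A`-linear). [folklore] -/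
def constCoeffQuot (D : PowerSeries A) (hXD : PowerSeries.X ∣ D) : (PowerSeries A ⧸ Ideal.span {D}) →ₗ[A] A where
  toFun := Ideal.Quotient.lift (Ideal.span {D}) (PowerSeries.constantCoeff (R := A)) (fun a ha => by
    rw [Ideal.mem_span_singleton] at ha
    obtain ⟨b, rfl⟩ := ha
    rw [map_mul, (PowerSeries.X_dvd_iff).mp hXD, zero_mul])
  map_add' := fun x y => map_add _ x y
  map_smul' := fun a x => by
    obtain ⟨g, rfl⟩ := Ideal.Quotient.mk_surjective x
    rw [RingHom.id_apply, ← Ideal.Quotient.mkₐ_eq_mk A, ← map_smul, Ideal.Quotient.mkₐ_eq_mk, Ideal.Quotient.lift_mk,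
      Ideal.Quotient.lift_mk, ← PowerSeries.coeff_zero_eq_constantCoeff_apply, ← PowerSeries.coeff_zero_eq_constantCoeff_apply,
      PowerSeries.coeff_smul]

/-- `constCoeffQuot` on the class of `1` is `1`. [folklore] -/
theorem constCoeffQuot_mk (D : PowerSeries A) (hXD : PowerSeries.X ∣ D) (g : PowerSeries A) :
    constCoeffQuot D hXD (Ideal.Quotient.mk (Ideal.span {D}) g) = PowerSeries.constantCoeff g := rfl

/-- `constCoeffQuot` on the class of `1` is `1`. [folklore] -/
theorem constCoeffQuot_mk_one (D : PowerSeries A) (hXD : PowerSeries.X ∣ D) :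
    constCoeffQuot D hXD (Ideal.Quotient.mk (Ideal.span {D}) 1) = 1 := by
  rw [constCoeffQuot_mk, map_one]

/-- **A decoration vanishing at the trivial character costs `≥ 1`.** If `X ∣ D` (the interpolated correction factor has a zero
at `T = 0`, i.e. at the trivial character) and `F ⊗ Λ/(D)` is finite-dimensional, then `1 ≤ λ(Λ/(D))` — so the undecorated
B⁻ (`D := 1`) under-books such a class by at least one. [cite: Washington1997, §7.1 Thm. 7.3 and §13.2] -/
theorem one_le_finrank_baseChange_quotient_of_X_dvd (D : PowerSeries A) (hXD : PowerSeries.X ∣ D)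
    [Module.Finite F (F ⊗[A] (PowerSeries A ⧸ Ideal.span {D}))] :
    1 ≤ Module.finrank F (F ⊗[A] (PowerSeries A ⧸ Ideal.span {D})) := by
  -- the `F`-linear functional `F ⊗ Λ/(D) → F ⊗ A ≃ F`, `y ⊗ ḡ ↦ y · g(0)`, does not vanish on `1 ⊗ 1̄`
  set g : F ⊗[A] (PowerSeries A ⧸ Ideal.span {D}) →ₗ[F] F :=
    (Algebra.TensorProduct.rid A F F).toLinearMap ∘ₗ ((constCoeffQuot D hXD).baseChange F) with hg
  have hne : (1 : F) ⊗ₜ[A] (Ideal.Quotient.mk (Ideal.span {D}) (1 : PowerSeries A)) ≠ 0 := by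
    intro h
    have h1 : g ((1 : F) ⊗ₜ[A] (Ideal.Quotient.mk (Ideal.span {D}) (1 : PowerSeries A))) = 1 := by
      rw [hg, LinearMap.comp_apply, LinearMap.baseChange_tmul, constCoeffQuot_mk_one, AlgEquiv.toLinearMap_apply,
        Algebra.TensorProduct.rid_tmul, one_smul]
    rw [h, map_zero] at h1
    exact zero_ne_one h1
  haveI : Nontrivial (F ⊗[A] (PowerSeries A ⧸ Ideal.span {D})) := nontrivial_of_ne _ _ hne
  exact Module.finrank_pos

end TrivialZero

/-! ## §0 Torsion under decoration (restated from `ZetaQuotientComposite` §1, whose module the farm snapshot does not yet serve) -/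

/-- Decorating a generator keeps the quotient torsion: `H/Λz₀` torsion and `D ≠ 0` ⇒ `H/Λ(D•z₀)` torsion
(`(D·b) • y ∈ Λ(D•z₀)` whenever `b • y ∈ Λz₀`). Same statement and proof as the landed
`ZetaQuotientComposite.isTorsion_quotient_span_smul` (credit: stub-ideation k2 g16 / width seat w2 g21).
[cite: Kato2004Asterisque, Thm. 12.4 (2) (p. 221)] -/
theorem isTorsion_quotient_span_smul' {R : Type*} [CommRing R] [IsDomain R] {H : Type*} [AddCommGroup H]
    [Module R H] (z₀ : H) (D : R) (hD : D ≠ 0) (htors : Module.IsTorsion R (H ⧸ Submodule.span R {z₀})) :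
    Module.IsTorsion R (H ⧸ Submodule.span R {D • z₀}) := by
  intro x
  induction x using Submodule.Quotient.induction_on with
  | H y =>
    obtain ⟨⟨b, hb⟩, hby⟩ := @htors ((Submodule.span R {z₀}).mkQ y)
    rw [Submonoid.mk_smul, Submodule.mkQ_apply, ← Submodule.Quotient.mk_smul,
      Submodule.Quotient.mk_eq_zero, Submodule.mem_span_singleton] at hby
    obtain ⟨a, ha⟩ := hby
    refine ⟨⟨D * b, mem_nonZeroDivisors_of_ne_zero (mul_ne_zero hD (nonZeroDivisors.ne_zero hb))⟩, ?_⟩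
    rw [Submonoid.mk_smul, ← Submodule.Quotient.mk_smul, Submodule.Quotient.mk_eq_zero, mul_smul, ← ha,
      smul_comm, Submodule.mem_span_singleton]
    exact ⟨a, by rw [smul_comm a D z₀]⟩

/-! ## §1 + §3 The decorated child B⁻_D on Kato's `𝐇¹_Γ(T)` and the certificate -/

section Kato

variable {A : Type} [CommRing A] [TopologicalSpace A] {V : Type} [AddCommGroup V] [Module A V] [TopologicalSpace V]
    [IsTopologicalAddGroup V] [ContinuousSMul A V] {T : GaloisRep ℚ A V} {p : ℕ} [Fact p.Prime]
    {κ : ZpExtension ℚ p} {γ : Field.absoluteGaloisGroup ℚ} {I : IwasawaH1DataCoeff T p κ γ}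
    [Module A I.H] [IsScalarTower A (PowerSeries A) I.H]
    (F : Type) [Field F] [Algebra A F]

/-- **B⁻_D — the `D`-decorated package-free child B** for a class `z ∈ 𝐇¹_Γ` and a bound module `X₀` (`= Sel₀^∨`):
`𝐇¹_Γ/Λz` is `Λ`-torsion and `λ(𝐇¹_Γ/Λz) ≤ λ(X₀) + λ(Λ/(D))` — S3″'s own `(ii)`-pair WITH its slack. At `D := 1` it is S132 α's B⁻
(`bminusD_one_iff`). [cite: BurungaleTian2026, Thm. 2.6 (p. 5)] [cite: Kato2004Asterisque, Thm. 12.4 (2), Thm. 12.5 (1)(2), Thm. 12.6 (pp. 221–222)] -/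
def BminusD (z : I.H) (X₀ : Type) [AddCommGroup X₀] [Module A X₀] (D : PowerSeries A) : Prop :=
  Module.IsTorsion (PowerSeries A) (I.H ⧸ Submodule.span (PowerSeries A) {z}) ∧
    Module.finrank F (F ⊗[A] (I.H ⧸ Submodule.span (PowerSeries A) {z})) ≤
      Module.finrank F (F ⊗[A] X₀) + Module.finrank F (F ⊗[A] (PowerSeries A ⧸ Ideal.span {D}))

/-- `B⁻_1 = B⁻`: with the unit decoration the slack vanishes and `BminusD F z X₀ 1` is literally S132 α's undecorated composite.
[cite: BurungaleTian2026, Thm. 2.6 (p. 5)] -/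
theorem bminusD_one_iff (z : I.H) (X₀ : Type) [AddCommGroup X₀] [Module A X₀] :
    BminusD F z X₀ 1 ↔
      Module.IsTorsion (PowerSeries A) (I.H ⧸ Submodule.span (PowerSeries A) {z}) ∧
        Module.finrank F (F ⊗[A] (I.H ⧸ Submodule.span (PowerSeries A) {z})) ≤ Module.finrank F (F ⊗[A] X₀) := by
  unfold BminusD
  rw [finrank_baseChange_quotient_span_one F, add_zero]

section Domain

variable [IsFractionRing A F]

/-- `B⁻_{C c} = B⁻` for a nonzero constant `c`: constant decorations change nothing (`finrank_baseChange_quotient_span_C`).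
[cite: Washington1997, §13.2] -/
theorem bminusD_C_iff (z : I.H) (X₀ : Type) [AddCommGroup X₀] [Module A X₀] (c : A) (hc : c ≠ 0) :
    BminusD F z X₀ (PowerSeries.C c) ↔
      Module.IsTorsion (PowerSeries A) (I.H ⧸ Submodule.span (PowerSeries A) {z}) ∧
        Module.finrank F (F ⊗[A] (I.H ⧸ Submodule.span (PowerSeries A) {z})) ≤ Module.finrank F (F ⊗[A] X₀) := by
  unfold BminusD
  rw [finrank_baseChange_quotient_span_C F c hc, add_zero]

section DVR

variable [IsDomain A] [IsDiscreteValuationRing A] [IsAdicComplete (IsLocalRing.maximalIdeal A) A]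

/-- **THE CERTIFICATE (`D := 1` for a decorated class over-claims by exactly `λ(Λ/(D))`).** For `z₀ ∈ 𝐇¹_Γ` without
`Λ`-torsion, `𝐇¹_Γ/Λz₀` torsion and `D ≠ 0`, the UNdecorated bound for the decorated class `D • z₀` is equivalent to the
decorated bound for `z₀` with the slack moved to the left: `λ(𝐇¹/Λ(D•z₀)) ≤ B ↔ λ(𝐇¹/Λz₀) + λ(Λ/(D)) ≤ B`
(landed `finrank_baseChange_quotient_span_smul_eq_add`). Read with `B := λ(Sel₀^∨)`: S132 α's B⁻ stated for a valued class
`z = D_A • z₀` whose correction factor interpolates to a NON-constant `D_A` asserts `λ(Λ/(D_A))` MORE than [BT26] ⊗ℚ ∘ PT gives for `z₀`.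
[cite: Kato2004Asterisque, Thm. 12.4 (2) (p. 221)] [cite: Washington1997, §13.2] -/
theorem bminus_smul_iff (hI : Module.Finite (PowerSeries A) I.H) (z₀ : I.H)
    (hz₀tf : ∀ a : PowerSeries A, a • z₀ = 0 → a = 0) (D : PowerSeries A) (hD : D ≠ 0)
    (htors : Module.IsTorsion (PowerSeries A) (I.H ⧸ Submodule.span (PowerSeries A) {z₀})) (B : ℕ) :
    Module.finrank F (F ⊗[A] (I.H ⧸ Submodule.span (PowerSeries A) {D • z₀})) ≤ B ↔
      Module.finrank F (F ⊗[A] (I.H ⧸ Submodule.span (PowerSeries A) {z₀})) +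
        Module.finrank F (F ⊗[A] (PowerSeries A ⧸ Ideal.span {D})) ≤ B := by
  haveI := hI
  rw [finrank_baseChange_quotient_span_smul_eq_add F z₀ hz₀tf D hD htors]

/-- **Corollary (the trap in one line).** If the undecorated B⁻ held for the decorated class `D • z₀`, then
`λ(Λ/(D)) ≤ λ(X₀) − λ(𝐇¹/Λz₀)`: the decoration's λ is charged against the Selmer side. With `X ∣ D` and [BT26]'s bound attained
(`λ(𝐇¹/Λz₀) = λ(X₀)`, the main-conjecture equality) this is `1 ≤ 0`. [cite: BurungaleTian2026, Thm. 2.6 and Rem. 2.7 (p. 5)] -/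
theorem finrank_quotient_span_le_sub_of_bminus_smul (hI : Module.Finite (PowerSeries A) I.H) (z₀ : I.H)
    (hz₀tf : ∀ a : PowerSeries A, a • z₀ = 0 → a = 0) (D : PowerSeries A) (hD : D ≠ 0)
    (htors : Module.IsTorsion (PowerSeries A) (I.H ⧸ Submodule.span (PowerSeries A) {z₀}))
    {X₀ : Type} [AddCommGroup X₀] [Module A X₀]
    (hB : Module.finrank F (F ⊗[A] (I.H ⧸ Submodule.span (PowerSeries A) {D • z₀})) ≤ Module.finrank F (F ⊗[A] X₀)) :
    Module.finrank F (F ⊗[A] (PowerSeries A ⧸ Ideal.span {D})) ≤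
      Module.finrank F (F ⊗[A] X₀) - Module.finrank F (F ⊗[A] (I.H ⧸ Submodule.span (PowerSeries A) {z₀})) := by
  have h := (bminus_smul_iff F hI z₀ hz₀tf D hD htors _).mp hB
  omega

/-- **The consistent booking.** From S132 α's B⁻ for a CLEAN class `z₀` (torsion-free, e.g. `2^a • z_{γ⁺}` of Kato 12.5 (1) ⊗ℚ)
and any decoration `D ≠ 0`: `BminusD F (D • z₀) X₀ D` — the decorated child for the decorated class, which is what k3's glue
feeds into S3″ with `z := D • z₀` (landed `ZetaQuotientComposite.ii_clauses_of_composite` gives the same `≤` plus finiteness).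
[cite: BurungaleTian2026, Thm. 2.6 (p. 5)] [cite: Kato2004Asterisque, Thm. 12.4 (2), Thm. 12.5 (1)(2) (pp. 221–222)] -/
theorem bminusD_smul_of_bminus (hI : Module.Finite (PowerSeries A) I.H) (z₀ : I.H)
    (hz₀tf : ∀ a : PowerSeries A, a • z₀ = 0 → a = 0) (D : PowerSeries A) (hD : D ≠ 0)
    {X₀ : Type} [AddCommGroup X₀] [Module A X₀]
    (htors : Module.IsTorsion (PowerSeries A) (I.H ⧸ Submodule.span (PowerSeries A) {z₀}))
    (hle : Module.finrank F (F ⊗[A] (I.H ⧸ Submodule.span (PowerSeries A) {z₀})) ≤ Module.finrank F (F ⊗[A] X₀)) :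
    BminusD F (D • z₀) X₀ D := by
  haveI := hI
  refine ⟨isTorsion_quotient_span_smul' z₀ D hD htors, ?_⟩
  rw [finrank_baseChange_quotient_span_smul_eq_add F z₀ hz₀tf D hD htors]
  exact Nat.add_le_add_right hle _

/-- **S3″'s `(ii)`-pair from B⁻_D, verbatim shape** (`Module.Finite ∧ ≤ … + λ(Λ/(D))`): the decorated child is consumed by the
glue with NO further algebra. [cite: Kato2004Asterisque, §13.8 (p. 228)] -/
theorem ii_clauses_of_bminusD (hI : Module.Finite (PowerSeries A) I.H) (z : I.H) {X₀ : Type} [AddCommGroup X₀] [Module A X₀] (D : PowerSeries A)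
    (h : BminusD F z X₀ D) :
    Module.Finite F (F ⊗[A] (I.H ⧸ Submodule.span (PowerSeries A) {z})) ∧
      Module.finrank F (F ⊗[A] (I.H ⧸ Submodule.span (PowerSeries A) {z})) ≤
        Module.finrank F (F ⊗[A] X₀) + Module.finrank F (F ⊗[A] (PowerSeries A ⧸ Ideal.span {D})) := by
  haveI := hI
  exact ⟨finite_baseChange_of_isTorsion F _ h.1, h.2⟩

end DVR

end Domain

end Kato

end Summit.BirchSwinnertonDyer.BirchSwinnertonDyer.Cruxes.ResidualThetaCountLowerPureAtTwo.SideaK4G23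

end
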